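import Batteries.Tactic.GeneralizeProofs
import Literature.AnabelianGeometry.SemiGraphs.InducedAlongSquare
import Literature.AnabelianGeometry.SemiGraphs.LocalizationLaws

/-!
# Localizations of semi-graphs of anabelioids: the squares `𝒢[v] → ℋ[f v] → ℋ` = `𝒢[v] → 𝒢 → ℋ` commute in the 1-category ([SemiAnbd] Def 4.1 (iv)) — merge step M4, part 3d

Mochizuki, *Semi-graphs of anabelioids*, Publ. RIMS **42** (2006), §4 Def 4.1 (iv) p.51 ("the
induced morphisms `H[c] → H'[c']`", which lie over `H → H'`) (kurims `paper:url-f33ace170ff4`).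
[cite: MochizukiSemiAnbd2006, Def 4.1 (iv), p. 51]

CONSTRUCTION (L3 bridge, step M4 part 3d; cell ruling abc-iut-L3-lead 2026-08-25T20:36Z): in the
1-category `SgAQuot` (arrows = 2-isomorphism classes of 1-morphisms):

* `HomOver.rebase` — reading a 1-morphism over `f` as one over an equal base `f'` (explicit
  transports on the components; `SgAQuot.homMk_rebase`: the class is unchanged);
* `HomOver.inducedAlongSquareIso2` — for a 1-morphism `φ` over `f` and a square
  `ι₁ ≫ f = κ ≫ ι₂`, a 2-cell between `(𝒢_{ι₁} → ℋ_{ι₂}) ∘→ ℋ` and (the rebase of) `(𝒢_{ι₁} → 𝒢) ∘→ φ`;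
  hence `homMk_inducedAlongSquare_comp`: the square commutes in `SgAQuot`;
* instances = the container law `locMapV_ι` / `locMapE_ι` of `InterfaceVocab.lean` at the real
  vocabulary: `homOf_atVertexMap_comp`, `homOf_atEdgeMap_comp`.
Nothing printed is asserted.
-/

namespace Literature.AnabelianGeometry.SemiGraphs

open CategoryTheory Literature.AnabelianGeometry.Anabelioids

universe v₁ u₁ u

namespace SemiGraphOfAnabelioids

variable {𝒢 ℋ : SemiGraphOfAnabelioids.{v₁, u₁, u}} {f f' : 𝒢.graph ⟶ ℋ.graph}

/-- Left-nested composites of transports merge (bookkeeping for the coherence proofs below).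
[folklore] -/
private theorem comp_eqToHom_trans {C : Type*} [Category C] {W X Y Z : C} (x : W ⟶ X) (p : X = Y)
    (q : Y = Z) : (x ≫ eqToHom p) ≫ eqToHom q = x ≫ eqToHom (p.trans q) := by
  cases p; cases q; simp

/-! ### Components of the square cell -/

/-- Components of `squareCell`: the transport of the component of `α₀` (in every use: of `φ_b`),
followed by an `eqToHom`. [cite: MochizukiSemiAnbd2006, Def 4.1 (iv), p. 51] -/
theorem HomOver.squareCell_hom_app (φ : HomOver 𝒢 ℋ f)
    (β₁ : 𝒢.graph.Branch) (v₁ : 𝒢.graph.Vertex)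
    (P : Anabelioids.Hom (𝒢.E (𝒢.graph.edgeOf β₁)) (𝒢.V v₁))
    (E₀ : 𝒢.graph.Edge) (p₁ : E₀ = 𝒢.graph.edgeOf β₁)
    (β₂ : ℋ.graph.Branch) (v₂ : ℋ.graph.Vertex) (hβ : f.branchMap β₁ = β₂)
    (hv : f.vertexMap v₁ = v₂)
    (E₀' : ℋ.graph.Edge) (p₂ : E₀' = ℋ.graph.edgeOf β₂) (q : f.edgeMap E₀ = E₀')
    (q₁ : f.edgeMap (𝒢.graph.edgeOf β₁) = ℋ.graph.edgeOf (f.branchMap β₁))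
    (Q₀ : Anabelioids.Hom (ℋ.E (ℋ.graph.edgeOf (f.branchMap β₁))) (ℋ.V (f.vertexMap v₁)))
    (Q : Anabelioids.Hom (ℋ.E (ℋ.graph.edgeOf β₂)) (ℋ.V v₂)) (hQ : HEq Q₀ Q)
    (α₀ : (φ.φV v₁).pullback ⋙ P.pullback ≅
      Q₀.pullback ⋙ (φ.φE (𝒢.graph.edgeOf β₁) (ℋ.graph.edgeOf (f.branchMap β₁)) q₁).pullback)
    (X : ℋ.V v₂) :
    (φ.squareCell β₁ v₁ P E₀ p₁ β₂ v₂ hβ hv E₀' p₂ q q₁ Q₀ Q hQ α₀).hom.app X =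
      (𝒢.idE E₀ _ p₁).pullback.map
          (α₀.hom.app ((ℋ.idV (f.vertexMap v₁) v₂ hv).pullback.obj X)) ≫
        eqToHom (by subst hβ; subst hv; subst p₁; subst p₂; cases hQ; rfl) := by
  subst hβ; subst hv; subst p₁; subst p₂; cases hQ
  simp only [HomOver.squareCell, Iso.trans_hom, NatTrans.comp_app, Functor.isoWhiskerRight_hom,
    Functor.whiskerRight_app, Functor.isoWhiskerLeft_hom, Functor.whiskerLeft_app,
    Functor.leftUnitor_hom_app, Functor.rightUnitor_hom_app, Iso.symm_hom,
    Functor.rightUnitor_inv_app, idE_rfl, Anabelioids.Hom.id_pullback, Functor.id_map]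
  repeat (first
    | erw [CategoryTheory.Functor.map_id]
    | erw [Category.id_comp]
    | erw [Category.comp_id]
    | erw [eqToHom_refl])

/-! ### Rebasing a 1-morphism along an equality of underlying morphisms of semi-graphs -/

/-- A 1-morphism over `f`, read as a 1-morphism over an equal `f'` (vertex components followed by
the transport `idV`, edge components re-indexed, 2-cells pasted from `φ_b`).
[cite: MochizukiSemiAnbd2006, Rmk 2.4.2, p. 26] -/
noncomputable def HomOver.rebase (φ : HomOver 𝒢 ℋ f) (f' : 𝒢.graph ⟶ ℋ.graph) (r : f = f') :
    HomOver 𝒢 ℋ f' where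
  φV v := (φ.φV v).comp (ℋ.idV (f.vertexMap v) (f'.vertexMap v) (by rw [r]))
  φE e e' h := φ.φE e e' (by rw [r]; exact h)
  φB c w hc :=
    φ.squareCell c w (𝒢.pull c w hc) (𝒢.graph.edgeOf c) rfl (f'.branchMap c) (f'.vertexMap w)
      (by rw [r]) (by rw [r]) (ℋ.graph.edgeOf (f'.branchMap c)) rfl (by subst r; exact (f.edgeOf_branchMap c).symm)
      (f.edgeOf_branchMap c).symm
      (ℋ.pull (f.branchMap c) (f.vertexMap w) (f.abuts_branchMap c w hc))
      (ℋ.pull (f'.branchMap c) (f'.vertexMap w) (f'.abuts_branchMap c w hc))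
      (pull_heq _ _ (by rw [r]) _ _ (by rw [r]) _ _) (φ.φB c w hc)

/-- Rebasing along `rfl` is 2-isomorphic to the identity operation.
[cite: MochizukiSemiAnbd2006, Rmk 2.4.2, p. 26] -/
noncomputable def HomOver.rebaseReflIso2 (φ : HomOver 𝒢 ℋ f) : HomOver.Iso2 (φ.rebase f rfl) φ where
  isoV v := Functor.leftUnitor _
  isoE e e' h := Iso.refl _
  coh c w hc := by
    ext X
    simp only [Iso.trans_hom, NatTrans.comp_app, Functor.isoWhiskerLeft_hom,
      Functor.whiskerLeft_app, Functor.isoWhiskerRight_hom, Functor.whiskerRight_app,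
      HomOver.rebase, HomOver.squareCell_hom_app, Iso.refl_hom, NatTrans.id_app,
      Functor.leftUnitor_hom_app, idE_rfl, idV_rfl, Anabelioids.Hom.id_pullback, Functor.id_map,
      Functor.id_obj]
    repeat (first
      | erw [CategoryTheory.Functor.map_id]
      | erw [Category.id_comp]
      | erw [Category.comp_id]
      | erw [eqToHom_refl])

/-- **The class of a rebased 1-morphism is the class of the 1-morphism** (as arrows of `SgAQuot`).
[cite: MochizukiSemiAnbd2006, Rmk 2.4.2, p. 26] -/
theorem _root_.Literature.AnabelianGeometry.SemiGraphs.SgAQuot.homMk_rebase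
    (φ : HomOver 𝒢 ℋ f) (f' : 𝒢.graph ⟶ ℋ.graph) (r : f = f') :
    (SgAQuot.homMk (φ.rebase f' r) : SgAQuot.mk 𝒢 ⟶ SgAQuot.mk ℋ) = SgAQuot.homMk φ := by
  subst r
  exact (SgAQuot.homMk_eq_homMk_iff _ _).mpr ⟨φ.rebaseReflIso2⟩

/-! ### The square 2-cell -/

/-- Reading an edge component at any presentation as one at a further-transported presentation
(identity after `subst`). [cite: MochizukiSemiAnbd2006, Rmk 2.4.2, p. 26] -/
noncomputable def HomOver.φEReindexIso' (φ : HomOver 𝒢 ℋ f) (E : 𝒢.graph.Edge) (x : ℋ.graph.Edge)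
    (q : f.edgeMap E = x) (e₂ : ℋ.graph.Edge) (h : x = e₂) :
    ((φ.φE E x q).comp (ℋ.idE x e₂ h)).pullback ≅ (φ.φE E e₂ (q.trans h)).pullback := by
  subst h; exact Functor.leftUnitor _

/-- Components of `φEReindexIso'`: an `eqToHom`. [cite: MochizukiSemiAnbd2006, Rmk 2.4.2, p. 26] -/
theorem HomOver.φEReindexIso'_hom_app (φ : HomOver 𝒢 ℋ f) (E : 𝒢.graph.Edge) (x : ℋ.graph.Edge)
    (q : f.edgeMap E = x) (e₂ : ℋ.graph.Edge) (h : x = e₂) (X : ℋ.E e₂) :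
    (φ.φEReindexIso' E x q e₂ h).hom.app X = eqToHom (by subst h; rfl) := by
  subst h; rfl

variable {H₁ H₂ : SemiGraph.{u}}

/-- **The square 2-cell**: for `φ` over `f` and a square `ι₁ ≫ f = κ ≫ ι₂`, the composite
`(𝒢_{ι₁} → ℋ_{ι₂}) ∘→ ℋ` is 2-isomorphic to (the rebase over `κ ≫ ι₂` of) `(𝒢_{ι₁} → 𝒢) ∘→ ℋ`.
[cite: MochizukiSemiAnbd2006, Def 4.1 (iv), p. 51] -/
noncomputable def HomOver.inducedAlongSquareIso2 (φ : HomOver 𝒢 ℋ f) (ι₁ : H₁ ⟶ 𝒢.graph)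
    (ι₂ : H₂ ⟶ ℋ.graph) (κ : H₁ ⟶ H₂) (r : ι₁ ≫ f = κ ≫ ι₂) :
    HomOver.Iso2 ((φ.inducedAlongSquare ι₁ ι₂ κ r).comp (ℋ.inducedAlongHomOver ι₂))
      (((𝒢.inducedAlongHomOver ι₁).comp φ).rebase (κ ≫ ι₂) r) where
  isoV w :=
    Functor.leftUnitor _ ≪≫
      Functor.isoWhiskerLeft
        (ℋ.idV (f.vertexMap (ι₁.vertexMap w)) (ι₂.vertexMap (κ.vertexMap w))
          (congrArg (fun t : H₁ ⟶ ℋ.graph => t.vertexMap w) r)).pullback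
        (φ.φV (ι₁.vertexMap w)).pullback.rightUnitor.symm
  isoE e e₂ h :=
    φ.φEReindexIso' (ι₁.edgeMap e) (ι₂.edgeMap (κ.edgeMap e))
        (congrArg (fun t : H₁ ⟶ ℋ.graph => t.edgeMap e) r) e₂ h ≪≫
      (Functor.rightUnitor _).symm
  coh c w hc := by
    ext X
    simp only [Iso.trans_hom, NatTrans.comp_app, Functor.isoWhiskerLeft_hom,
      Functor.whiskerLeft_app, Functor.isoWhiskerRight_hom, Functor.whiskerRight_app,
      HomOver.comp, HomOver.rebase, HomOver.inducedAlongSquare, inducedAlongHomOver,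
      HomOver.compCell_hom_app, HomOver.compEIso_hom_app, HomOver.squareCell_hom_app,
      HomOver.φEReindexIso'_hom_app, Iso.symm_hom, Functor.leftUnitor_hom_app,
      Functor.rightUnitor_inv_app, idE_rfl, Anabelioids.Hom.id_pullback, Functor.id_map,
      Functor.id_obj, Functor.map_comp]
    repeat (first
      | erw [CategoryTheory.Functor.map_id]
      | erw [Category.id_comp]
      | erw [Category.comp_id])
    repeat erw [comp_eqToHom_trans]
    rfl

/-- **In the 1-category, the square `(𝒢_{ι₁} → ℋ_{ι₂}) ≫ (ℋ_{ι₂} → ℋ) = (𝒢_{ι₁} → 𝒢) ≫ φ`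
commutes.** [cite: MochizukiSemiAnbd2006, Def 4.1 (iv), p. 51] -/
theorem HomOver.homMk_inducedAlongSquare_comp (φ : HomOver 𝒢 ℋ f) (ι₁ : H₁ ⟶ 𝒢.graph)
    (ι₂ : H₂ ⟶ ℋ.graph) (κ : H₁ ⟶ H₂) (r : ι₁ ≫ f = κ ≫ ι₂) :
    (SgAQuot.homMk ((φ.inducedAlongSquare ι₁ ι₂ κ r).comp (ℋ.inducedAlongHomOver ι₂)) :
        SgAQuot.mk (𝒢.inducedAlong ι₁) ⟶ SgAQuot.mk ℋ) =
      SgAQuot.homMk ((𝒢.inducedAlongHomOver ι₁).comp φ) := by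
  rw [← SgAQuot.homMk_rebase ((𝒢.inducedAlongHomOver ι₁).comp φ) (κ ≫ ι₂) r]
  exact (SgAQuot.homMk_eq_homMk_iff _ _).mpr ⟨φ.inducedAlongSquareIso2 ι₁ ι₂ κ r⟩

/-! ### Instances: the container laws `locMapV_ι`, `locMapE_ι` for the real localizations -/

/-- **`(𝒢[v] → ℋ[f v]) ≫ (ℋ[f v] → ℋ) = (𝒢[v] → 𝒢) ≫ φ`** in the 1-category (Def 4.1 (iv): the
induced morphism lies over `φ`). [cite: MochizukiSemiAnbd2006, Def 4.1 (iv), p. 51] -/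
theorem homOf_atVertexMap_comp (φ : Hom 𝒢 ℋ) (v : 𝒢.graph.Vertex) :
    SgAQuot.homOf (φ.over.atVertexMap v) ≫ SgAQuot.homOf (ℋ.atVertexHom (φ.base.vertexMap v)) =
      SgAQuot.homOf (𝒢.atVertexHom v) ≫ SgAQuot.homOf φ :=
  HomOver.homMk_inducedAlongSquare_comp φ.over (𝒢.graph.atVertexHom v)
    (ℋ.graph.atVertexHom (φ.base.vertexMap v)) (SemiGraph.atVertexMap φ.base v)
    (SemiGraph.atVertexMap_comp_atVertexHom φ.base v).symm

/-- **`(𝒢[e] → ℋ[f e]) ≫ (ℋ[f e] → ℋ) = (𝒢[e] → 𝒢) ≫ φ`** in the 1-category.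
[cite: MochizukiSemiAnbd2006, Def 4.1 (iv), p. 51] -/
theorem homOf_atEdgeMap_comp (φ : Hom 𝒢 ℋ) (e : 𝒢.graph.Edge) :
    SgAQuot.homOf (φ.over.atEdgeMap e) ≫ SgAQuot.homOf (ℋ.atEdgeHom (φ.base.edgeMap e)) =
      SgAQuot.homOf (𝒢.atEdgeHom e) ≫ SgAQuot.homOf φ :=
  HomOver.homMk_inducedAlongSquare_comp φ.over (𝒢.graph.atEdgeHom e)
    (ℋ.graph.atEdgeHom (φ.base.edgeMap e)) (SemiGraph.atEdgeMap φ.base e)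
    (SemiGraph.atEdgeMap_comp_atEdgeHom φ.base e).symm

/-! ### Functoriality on identities: `𝒢[v] → 𝒢[v]` induced by the identity is the identity -/

/-- The 2-cell between the 1-morphism `𝒢[v] → 𝒢[v]` induced by the identity of `𝒢` (over the
identity of `𝔾[v]`, definitionally `SemiGraph.atVertexMap (𝟙 𝔾) v`) and the identity 1-morphism of
`𝒢[v]` (all components transports). [cite: MochizukiSemiAnbd2006, Def 4.1 (iv), p. 51] -/
noncomputable def atVertexMapIdIso2 (𝒢 : SemiGraphOfAnabelioids.{v₁, u₁, u}) (v : 𝒢.graph.Vertex) :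
    HomOver.Iso2
      ((HomOver.id 𝒢).inducedAlongSquare (𝒢.graph.atVertexHom v) (𝒢.graph.atVertexHom v)
        (SemiGraph.atVertexMap (𝟙 𝒢.graph) v)
        (SemiGraph.atVertexMap_comp_atVertexHom (𝟙 𝒢.graph) v).symm)
      (HomOver.id (𝒢.atVertex v)) where
  isoV w := Functor.leftUnitor _
  isoE e e' h := eqToIso (by subst h; rfl)
  coh c w hc := by
    ext X
    simp only [Iso.trans_hom, NatTrans.comp_app, Functor.isoWhiskerLeft_hom,
      Functor.whiskerLeft_app, Functor.isoWhiskerRight_hom, Functor.whiskerRight_app,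
      HomOver.inducedAlongSquare, HomOver.id, HomOver.squareCell_hom_app, eqToIso.hom,
      eqToHom_app, Iso.symm_hom, Functor.leftUnitor_hom_app, Functor.rightUnitor_inv_app,
      Anabelioids.Hom.id_pullback, Functor.id_obj, Functor.map_comp]
    generalize_proofs
    repeat (first
      | erw [CategoryTheory.Functor.map_id]
      | erw [Category.id_comp]
      | erw [Category.comp_id])
    rfl

/-- **`𝒢[v] → 𝒢[v]` induced by the identity of `𝒢` is the identity** in the 1-category (container
law `locMapV_id` at the real vocabulary). [cite: MochizukiSemiAnbd2006, Def 4.1 (iv), p. 51] -/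
theorem homOf_atVertexMap_id (𝒢 : SemiGraphOfAnabelioids.{v₁, u₁, u}) (v : 𝒢.graph.Vertex) :
    SgAQuot.homOf ((Hom.id 𝒢).over.atVertexMap v) = 𝟙 (SgAQuot.mk (𝒢.atVertex v)) :=
  (SgAQuot.homMk_eq_homMk_iff _ _).mpr ⟨atVertexMapIdIso2 𝒢 v⟩

/-- The 2-cell between `𝒢[e] → 𝒢[e]` induced by the identity of `𝒢` and the identity of `𝒢[e]`.
[cite: MochizukiSemiAnbd2006, Def 4.1 (iv), p. 51] -/
noncomputable def atEdgeMapIdIso2 (𝒢 : SemiGraphOfAnabelioids.{v₁, u₁, u}) (e : 𝒢.graph.Edge) :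
    HomOver.Iso2
      ((HomOver.id 𝒢).inducedAlongSquare (𝒢.graph.atEdgeHom e) (𝒢.graph.atEdgeHom e)
        (SemiGraph.atEdgeMap (𝟙 𝒢.graph) e)
        (SemiGraph.atEdgeMap_comp_atEdgeHom (𝟙 𝒢.graph) e).symm)
      (HomOver.id (𝒢.atEdge e)) where
  isoV w := Functor.leftUnitor _
  isoE e₁ e' h := eqToIso (by subst h; rfl)
  coh c w hc := by
    ext X
    simp only [Iso.trans_hom, NatTrans.comp_app, Functor.isoWhiskerLeft_hom,
      Functor.whiskerLeft_app, Functor.isoWhiskerRight_hom, Functor.whiskerRight_app,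
      HomOver.inducedAlongSquare, HomOver.id, HomOver.squareCell_hom_app, eqToIso.hom,
      eqToHom_app, Iso.symm_hom, Functor.leftUnitor_hom_app, Functor.rightUnitor_inv_app,
      Anabelioids.Hom.id_pullback, Functor.id_obj, Functor.map_comp]
    generalize_proofs
    repeat (first
      | erw [CategoryTheory.Functor.map_id]
      | erw [Category.id_comp]
      | erw [Category.comp_id])
    rfl

/-- **`𝒢[e] → 𝒢[e]` induced by the identity of `𝒢` is the identity** in the 1-category (container
law `locMapE_id` at the real vocabulary). [cite: MochizukiSemiAnbd2006, Def 4.1 (iv), p. 51] -/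
theorem homOf_atEdgeMap_id (𝒢 : SemiGraphOfAnabelioids.{v₁, u₁, u}) (e : 𝒢.graph.Edge) :
    SgAQuot.homOf ((Hom.id 𝒢).over.atEdgeMap e) = 𝟙 (SgAQuot.mk (𝒢.atEdge e)) :=
  (SgAQuot.homMk_eq_homMk_iff _ _).mpr ⟨atEdgeMapIdIso2 𝒢 e⟩

end SemiGraphOfAnabelioids

end Literature.AnabelianGeometry.SemiGraphs
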